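import Summits.QuantumFields.YangMills.Theorems.SwapTwistDeficitTwistDeficitRungFixedL
import HarnessLib

/-!
# `SwapTwistDeficit.TwistDeficit` from ONE swap-odd quasimode per `(β, L)` and the sub-femto entropy bound — a by-name variational door
# (route `SwapTwistDeficit`, item stmt-QuantumFields-23317; D-0145 LINE g10-B of seat ym-idea-4)

The crux `TwistDeficit` asks `β^{-k} Z(2L) ≤ Z(2L) − Z^S(2L)` uniformly on the sub-femto window `L₀ ≤ L ≤ β^A`.  The fixed-`L` rung
(`twistDeficit_rung_fixedL`) rests on the odd-sector variational bound `physTrace_sub_twistTrace_ge`: for ANY swap-odd physical `ψ ≠ 0`,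
`Z(2L) − Z^S(2L) ≥ 2 (q_β(ψ,ψ)/‖ψ‖²)^{2L}`.  This file turns that bound into a DOOR for the crux itself:

* ★ `twistDeficit_of_oddQuasimode`: IF on the window there is, for every `(β, L)`, a swap-odd physical test function `ψ` with Rayleigh quotient
  `q_β(ψ,ψ)/‖ψ‖² ≥ β^{−a/(2L)} λ₀(β,L)` («odd quasimode»: energy per time step within `(a log β)/(2L)` of the vacuum — the docstring's
  «(λ₁^odd/λ₀)^{2L} ≳ β^{−a}» made variational, so that Polyakov-lift ∕ toron trial vectors evaluated to LOGARITHMIC precision suffice), AND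
  `SubFemtoEntropy` holds (`Z(L) ≤ β^q λ₀^L` on the window), THEN `TwistDeficit` holds (with `k = a + 2q + 1`):
  `Z − Z^S ≥ 2β^{−a}λ₀^{2L} ≥ 2β^{−a−2q} Z(L)² ≥ 2β^{−a−2q} Z(2L)` (`Z(2L) = Σλ^{2L} ≤ (Σλ^L)² = Z(L)²`).
* `physTrace_two_mul_le_sq`: `Z(2L) ≤ Z(L)²` (`β ≥ 1`, `L ≥ 2`).

HONEST FRAMING: a reduction (pure transfer-matrix bookkeeping at fixed lattice), not a proof of the crux: the odd quasimode hypothesis carries the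
whole semiclassical ∕ renormalisation-group content (uniformity in `L ≤ β^A`).  No summit, no mass gap; K2a, R2ξ″ and the Clay problem OPEN.
No `sorry`, no new axiom, no new definition.  References: [cite: ReedSimonIV1978, Thm. XIII.1]; [cite: tHooft1979Flux]; [cite: Luscher1983, §2].
-/

set_option autoImplicit false

noncomputable section

open MeasureTheory Filter Topology Real Function
open Literature.MathematicalPhysics.QuantumLattice
open Literature.MathematicalPhysics.QuantumFieldTheory hiding SU2
open Summit.QuantumFields.YangMills.Theorems
open Summit.QuantumFields.YangMills.Theorems.FemtoTransferGap
open scoped BigOperators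

namespace Summit.QuantumFields.YangMills.Theorems.SwapTwistDeficit

/-- `Z_phys(2L) ≤ Z_phys(L)²` for `β ≥ 1`, `L ≥ 2`: `Σ_k λ_k^{2L} ≤ (Σ_k λ_k^L)²` termwise (`λ_k^L ≤ Z(L)`, all `λ_k ≥ 0`). [cite: MontvayMunster1994, (3.145)] -/
theorem physTrace_two_mul_le_sq (L : ℕ) [NeZero L] (hL : 2 ≤ L) {β : ℝ} (hβ : 1 ≤ β) :
    TT.physTrace L β (2 * L) ≤ TT.physTrace L β L ^ 2 := by
  have hβ0 : 0 < β := by linarith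
  have h1 := TT.traceFormula_all L β L hβ (by omega)
  have h2 := TT.traceFormula_all L β (2 * L) hβ (by omega)
  have hnn : ∀ k, 0 ≤ levelValue su2Rep L β k ^ L := fun k => pow_nonneg (levelValue_su2Rep_pos hβ0 k).le _
  have hle : ∀ k, levelValue su2Rep L β k ^ L ≤ TT.physTrace L β L := fun k => le_hasSum h1 k fun j _ => hnn j
  have h3 : HasSum (fun k => levelValue su2Rep L β k ^ L * TT.physTrace L β L) (TT.physTrace L β L * TT.physTrace L β L) :=
    h1.mul_right _
  have hterm : ∀ k, levelValue su2Rep L β k ^ (2 * L) ≤ levelValue su2Rep L β k ^ L * TT.physTrace L β L := fun k => by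
    rw [show 2 * L = L + L by ring, pow_add]
    exact mul_le_mul_of_nonneg_left (hle k) (hnn k)
  rw [sq]
  exact hasSum_le hterm h2 h3

/-- ★ **`TwistDeficit` from odd quasimodes and the sub-femto entropy.**  If (i) on the sub-femto window there is for every `(β, L)` a swap-odd
physical test function `ψ` with `‖ψ‖² > 0` and `β^{−a/(2L)} λ₀(β,L) ‖ψ‖² ≤ q_β(ψ,ψ)`, and (ii) `SubFemtoEntropy` holds, then `TwistDeficit` holds.
[cite: ReedSimonIV1978, Thm. XIII.1] [cite: tHooft1979Flux] -/
theorem twistDeficit_of_oddQuasimode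
    (hodd : ∀ A : ℝ, 0 < A → ∃ a β₀ : ℝ, ∃ L₀ : ℕ, ∀ β : ℝ, β₀ ≤ β → ∀ (L : ℕ) [NeZero L], L₀ ≤ L → (L : ℝ) ≤ β ^ A →
        ∃ ψ : GaugeConfig 3 L FemtoTransferGap.SU2 → ℝ, IsPhys ψ ∧ (∀ U, ψ (configPerm (Equiv.swap (0 : Fin 3) 1) U) = -ψ U) ∧
          0 < l2 ψ ψ ∧ β ^ (-a / (2 * (L : ℝ))) * levelValue su2Rep L β 0 * l2 ψ ψ ≤ qform su2Rep β ψ ψ)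
    (hent : Summit.QuantumFields.YangMills.Theses.SwapTwistDeficit.SubFemtoEntropy) :
    Summit.QuantumFields.YangMills.Theses.SwapTwistDeficit.TwistDeficit := by
  intro A hA
  obtain ⟨a, β₀, L₀, hψ⟩ := hodd A hA
  obtain ⟨q, β₀', L₀', hZ⟩ := hent A hA
  refine ⟨a + 2 * q + 1, max (max β₀ β₀') 2, max (max L₀ L₀') 2, fun β hβ L _ hL hLA => ?_⟩
  have hββ₀ : β₀ ≤ β := ((le_max_left _ _).trans (le_max_left _ _)).trans hβ
  have hββ₀' : β₀' ≤ β := ((le_max_right _ _).trans (le_max_left _ _)).trans hβ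
  have hβ2 : 2 ≤ β := (le_max_right _ _).trans hβ
  have hβ1 : 1 ≤ β := by linarith
  have hβ0 : 0 < β := by linarith
  have hLL₀ : L₀ ≤ L := ((le_max_left _ _).trans (le_max_left _ _)).trans hL
  have hLL₀' : L₀' ≤ L := ((le_max_right _ _).trans (le_max_left _ _)).trans hL
  have hL2 : 2 ≤ L := (le_max_right _ _).trans hL
  have hLpos : (0 : ℝ) < L := by exact_mod_cast (show 0 < L by omega)
  obtain ⟨ψ, hψP, hψodd, hψpos, hψq⟩ := hψ β hββ₀ L hLL₀ hLA
  have hZL := hZ β hββ₀' L hLL₀' hLA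
  set lam0 := levelValue su2Rep L β 0 with hlam0
  have hl0 : 0 < lam0 := levelValue_zero_su2Rep_pos L β
  -- Rayleigh quotient `R ≥ β^{-a/(2L)} λ₀`
  have hR : β ^ (-a / (2 * (L : ℝ))) * lam0 ≤ qform su2Rep β ψ ψ / l2 ψ ψ := by
    rw [le_div_iff₀ hψpos]; exact hψq
  have hR0 : 0 ≤ β ^ (-a / (2 * (L : ℝ))) * lam0 := mul_nonneg (Real.rpow_nonneg hβ0.le _) hl0.le
  -- the odd-sector door
  have hdoor := physTrace_sub_twistTrace_ge hL2 hβ1 hψP hψodd hψpos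
  have hpow : (β ^ (-a / (2 * (L : ℝ))) * lam0) ^ (2 * L) ≤ (qform su2Rep β ψ ψ / l2 ψ ψ) ^ (2 * L) := pow_le_pow_left₀ hR0 hR _
  have hpow' : (β ^ (-a / (2 * (L : ℝ))) * lam0) ^ (2 * L) = β ^ (-a) * lam0 ^ (2 * L) := by
    rw [mul_pow, ← Real.rpow_natCast (β ^ (-a / (2 * (L : ℝ)))) (2 * L), ← Real.rpow_mul hβ0.le]
    congr 2
    push_cast
    field_simp
  -- entropy: `λ₀^{2L} ≥ β^{-2q} Z(L)² ≥ β^{-2q} Z(2L)`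
  have hZ0 : 0 ≤ TT.physTrace L β L :=
    (TT.traceFormula_all L β L hβ1 (by omega)).nonneg fun k => pow_nonneg (levelValue_su2Rep_pos hβ0 k).le _
  have hsq : TT.physTrace L β L ^ 2 ≤ (β ^ q * lam0 ^ L) ^ 2 := pow_le_pow_left₀ hZ0 hZL 2
  have h2L := physTrace_two_mul_le_sq L (by omega) hβ1
  have hent' : β ^ (-(2 * q)) * TT.physTrace L β (2 * L) ≤ lam0 ^ (2 * L) := by
    have e1 : (β ^ q * lam0 ^ L) ^ 2 = β ^ (2 * q) * lam0 ^ (2 * L) := by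
      rw [mul_pow, ← pow_mul, ← Real.rpow_natCast (β ^ q) 2, ← Real.rpow_mul hβ0.le, show L * 2 = 2 * L by ring]
      congr 2; push_cast; ring
    have hq0 : 0 < β ^ (2 * q) := Real.rpow_pos_of_pos hβ0 _
    rw [Real.rpow_neg hβ0.le, ← div_eq_inv_mul, div_le_iff₀ hq0]
    calc TT.physTrace L β (2 * L) ≤ TT.physTrace L β L ^ 2 := h2L
      _ ≤ (β ^ q * lam0 ^ L) ^ 2 := hsq
      _ = lam0 ^ (2 * L) * β ^ (2 * q) := by rw [e1, mul_comm]
  -- assemble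
  have hZ2 : 0 ≤ TT.physTrace L β (2 * L) :=
    (TT.traceFormula_all L β (2 * L) hβ1 (by omega)).nonneg fun k => pow_nonneg (levelValue_su2Rep_pos hβ0 k).le _
  have e2 : β ^ (-(a + 2 * q + 1)) = β ^ (-a) * β ^ (-(2 * q)) * β⁻¹ := by
    rw [show -(a + 2 * q + 1) = -a + -(2 * q) + (-1 : ℝ) by ring, Real.rpow_add hβ0, Real.rpow_add hβ0, Real.rpow_neg_one]
  have hβinv : β⁻¹ ≤ 2 := by
    rw [inv_le_comm₀ hβ0 (by norm_num)]; linarith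
  calc β ^ (-(a + 2 * q + 1)) * TT.physTrace L β (2 * L)
      = β⁻¹ * (β ^ (-a) * (β ^ (-(2 * q)) * TT.physTrace L β (2 * L))) := by rw [e2]; ring
    _ ≤ 2 * (β ^ (-a) * lam0 ^ (2 * L)) :=
        mul_le_mul hβinv (mul_le_mul_of_nonneg_left hent' (Real.rpow_nonneg hβ0.le _))
          (mul_nonneg (Real.rpow_nonneg hβ0.le _) (mul_nonneg (Real.rpow_nonneg hβ0.le _) hZ2)) (by norm_num)
    _ = 2 * (β ^ (-a / (2 * (L : ℝ))) * lam0) ^ (2 * L) := by rw [hpow']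
    _ ≤ 2 * (qform su2Rep β ψ ψ / l2 ψ ψ) ^ (2 * L) := by linarith
    _ ≤ TT.physTrace L β (2 * L) - TT.twistTrace L β (2 * L) := hdoor

end Summit.QuantumFields.YangMills.Theorems.SwapTwistDeficit

end
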